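/-
Copyright (c) 2026 the pub-hodgecm-mathlib formalisation cell (harness21).  Prover seat hodgecm-mathlib-K2E1-p04 (g2), Track B ∕ K2-LIT
(build stream 29), h413 = `stmt-HodgeConjecture-24833`, line `K2_E1_TraceFormulaBeta`; BY-NAME DEAL (9) of the dealer K2E1-plan (g0)
2026-09-03T23:12:30Z (`K2E1LocalIrrepAdmissibleU2`), file 2: the structure of `U(σ, Φ₂)(K)` feeding Harish-Chandra's support theorem.
-/
import Summits.HodgeConjecture.HodgeConjecture.Theorems.K2E1RamifiedSpecialGelfandPairU2   -- ★ p855539∕p855507: the `η`-level, Cartan in the symplectic model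
import Literature.NumberTheory.Automorphic.UnitaryGroupBorelInduction                     -- ★ `unipotentU`, `mem_unipotentU_iff`
import Literature.NumberTheory.Automorphic.CongruenceSubgroupExpansionGL                  -- ★ `congruenceGL`, `IsUniformizingElement`, `exists_congruenceGL_pow_subset`
import HarnessLib

/-!
# K2·E1 — `K2E1CuspidalCartanU2`: the structure of `U(σ, Φ₂)(K)` used by Harish-Chandra's cuspidal theorem — the CARTAN-TYPE EXHAUSTION
# `U = ⋃_{n ≥ 0} K′ t₁ⁿ K′ · Z` for the `η`-level `K′`, the torus element `t₁ = d(ϖ, (σϖ)⁻¹)`, and the contraction of the unipotent radical by `t₁`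

Track B ∕ K2-LIT, crux h413 = `stmt-HodgeConjecture-24833`, route of record `HCCMUnconditional`; cell `hodgecm-mathlib`, squad K2; prover seat
`hodgecm-mathlib-K2E1-p04` (g2), deal (9) of the dealer K2E1-plan (g0); lane `--supports stmt-HodgeConjecture-24833 --as helper` (count-neutral).
THEOREMS ONLY (no `def`, no `instance`, no notation, no named-fact hypothesis, no `sorry`).

WHY.  ★ `Representation.isSupercuspidal_of_subsingleton_coinvariants_of_cartan` (`JacquetCuspidalCompactCoefficients`, [BernsteinZelevinsky1976 §3.18–3.21],
[Casselman1995 Thm. 5.3.1]) turns «Jacquet module zero ⇒ supercuspidal (⇒ admissible)» into STRUCTURE of the group: a contracting element `a`, a filtration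
of the unipotent radical, and `G = ⋃_{n ≥ 0} K₀ aⁿ K₀ · Z(G)`.  This file supplies that structure for `U := U(σ, Φ₂)(K)` (`Φ₂ = [[0,1],[1,0]]`, `K` a
non-archimedean local field, `σ` an isometric involution, `η ∈ K^×` with `ση = −η`, `P = d(1, η)`, `K′ = U ∩ P GL₂(𝒪) P⁻¹` the `η`-level of ★ p855539,
`ϖ` a uniformiser of `K`, `t₁ = d(ϖ, (σϖ)⁻¹) ∈ U`):
* §1 explicit elements: `t₁ⁿ`, unit diagonals `d(u, (σu)⁻¹) ∈ K′`, the Weyl element `w′ = [[0, η⁻¹],[−η, 0]] ∈ K′` with `w′ t₁ w′⁻¹ · c = t₁⁻¹` for the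
  central unit scalar `c = σϖ∕ϖ`;
* §2 **`exists_etaLevel_mul_pow_mul_scalar`** — `∀ g ∈ U, g = k₁ t₁ⁿ k₂ z` with `k₁, k₂ ∈ K′`, `n : ℕ`, `z ∈ U` a scalar (CENTRAL): Cartan normal form of
  ★ p855507 conjugated by `P`, `p = u ϖ^{±m}` in the DVR `𝒪_K`, and the Weyl trick for negative exponents;
* §3 the unipotent radical: `coe_eq_of_mem_unipotentU` (`n = [[1,b],[0,1]]`), `coe_pow_mul_mul_pow_inv` (`t₁ᵐ n t₁⁻ᵐ = [[1,(ϖσϖ)ᵐ b],[0,1]]`),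
  `upper_mem_conj_glInt_iff` (`[[1,c],[0,1]] ∈ P GL₂(𝒪) P⁻¹ ⇔ |cη| ≤ 1`), `upper_mem_congruenceGL` (small `c` ⇒ principal congruence subgroup),
  `exists_pow_valuation_mul_le` (archimedean bookkeeping).
The transport to `G_v = U(Φ₂)(L⁺_v)` and the assembly of Harish-Chandra + ★ `K2E1LocalIrrepAdmissibleU2` is the companion `K2E1CuspidalAdmissibleU2`.

HONEST LABEL: HC_CM is proved only modulo the 7 printed citations (2 remaining named inputs: hLiu418 = `stmt-HodgeConjecture-24832`, h413 =
`stmt-HodgeConjecture-24833`) until rung 0 closes; this file moves no counter.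
-/

set_option autoImplicit false
-- the mandated namespace repeats the single-problem summit's segment (`HodgeConjecture.HodgeConjecture`)
set_option linter.dupNamespace false

open scoped MatrixGroups ValuativeRel
open Matrix ValuativeRel Literature.NumberTheory.Automorphic Literature.NumberTheory.Automorphic.UnitaryGroup

namespace Summit.HodgeConjecture.HodgeConjecture.Cruxes.H413.K2E1CuspidalCartanU2

variable {K : Type*} [Field K]

/-! ## §1 Explicit elements of `U(σ, Φ₂)` -/

/-- A matrix-level membership test for `U(σ, Φ₂)`, `Φ₂ = [[0,1],[1,0]]`. [folklore] -/
theorem mem_of_coe_eq {σ : K →+* K} {J : Matrix (Fin 2) (Fin 2) K} (hJ : J = !![0, 1; 1, 0]) {u : GL (Fin 2) K}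
    {A : Matrix (Fin 2) (Fin 2) K} (hu : (u : Matrix (Fin 2) (Fin 2) K) = A) (hA : (A.map σ)ᵀ * !![(0 : K), 1; 1, 0] * A = !![(0 : K), 1; 1, 0]) :
    u ∈ unitaryGroupOfForm σ J := by
  subst hJ; rw [mem_unitaryGroupOfForm_iff, hu]; exact hA

/-- `X ∈ P GL₂(𝒪) P⁻¹ ⇔ P⁻¹ X P ∈ GL₂(𝒪)`. [folklore] -/
theorem mem_conj_glInt_iff [ValuativeRel K] (P X : GL (Fin 2) K) :
    X ∈ (glInt 2 K).map (MulAut.conj P).toMonoidHom ↔ P⁻¹ * X * P ∈ glInt 2 K := by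
  rw [Subgroup.mem_map_equiv, MulAut.conj_symm_apply]

/-- The inverse of `P = d(1, η)` is `d(1, η⁻¹)`. [folklore] -/
theorem coe_inv_of_coe_eq_diag {η : K} (hη0 : η ≠ 0) (P : GL (Fin 2) K) (hP : (P : Matrix (Fin 2) (Fin 2) K) = !![1, 0; 0, η]) :
    ((P⁻¹ : GL (Fin 2) K) : Matrix (Fin 2) (Fin 2) K) = !![1, 0; 0, η⁻¹] := by
  rw [Matrix.coe_units_inv, hP]
  exact Matrix.inv_eq_right_inv (by simp [Matrix.one_fin_two, mul_inv_cancel₀ hη0])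

/-- **A diagonal `d(α, β)` with `α, β, α⁻¹, β⁻¹ ∈ 𝒪` lies in `P GL₂(𝒪) P⁻¹`** (it commutes with `P = d(1,η)`). [folklore] -/
theorem diag_mem_conj_glInt [ValuativeRel K] {η : K} (hη0 : η ≠ 0) (P : GL (Fin 2) K) (hP : (P : Matrix (Fin 2) (Fin 2) K) = !![1, 0; 0, η])
    {d : GL (Fin 2) K} {α β : K} (hd : (d : Matrix (Fin 2) (Fin 2) K) = !![α, 0; 0, β])
    (hd' : ((d⁻¹ : GL (Fin 2) K) : Matrix (Fin 2) (Fin 2) K) = !![α⁻¹, 0; 0, β⁻¹])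
    (hα : valuation K α = 1) (hβ : valuation K β = 1) : d ∈ (glInt 2 K).map (MulAut.conj P).toMonoidHom := by
  have hPi := coe_inv_of_coe_eq_diag hη0 P hP
  have h1 : ((P⁻¹ * d * P : GL (Fin 2) K) : Matrix (Fin 2) (Fin 2) K) = !![α, 0; 0, β] := by
    rw [Units.val_mul, Units.val_mul, hPi, hd, hP]
    ext i j; fin_cases i <;> fin_cases j <;> simp [Matrix.mul_apply, Fin.sum_univ_two]
    rw [mul_comm η⁻¹ β, mul_assoc, inv_mul_cancel₀ hη0, mul_one]
  have h2 : (((P⁻¹ * d * P)⁻¹ : GL (Fin 2) K) : Matrix (Fin 2) (Fin 2) K) = !![α⁻¹, 0; 0, β⁻¹] := by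
    rw [_root_.mul_inv_rev, _root_.mul_inv_rev, inv_inv, ← mul_assoc, Units.val_mul, Units.val_mul, hPi, hd', hP]
    ext i j; fin_cases i <;> fin_cases j <;> simp [Matrix.mul_apply, Fin.sum_univ_two]
    rw [mul_comm η⁻¹ β⁻¹, mul_assoc, inv_mul_cancel₀ hη0, mul_one]
  have hαO : α ∈ 𝒪[K] := by rw [Valuation.mem_integer_iff, hα]
  have hβO : β ∈ 𝒪[K] := by rw [Valuation.mem_integer_iff, hβ]
  have hαO' : α⁻¹ ∈ 𝒪[K] := by rw [Valuation.mem_integer_iff, map_inv₀, hα, inv_one]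
  have hβO' : β⁻¹ ∈ 𝒪[K] := by rw [Valuation.mem_integer_iff, map_inv₀, hβ, inv_one]
  rw [mem_conj_glInt_iff, mem_glInt_iff, h1, h2]
  refine ⟨fun i j => ?_, fun i j => ?_⟩ <;> fin_cases i <;> fin_cases j <;> simp [hαO, hβO, hαO', hβO', zero_mem]

section Valued

variable [ValuativeRel K] (σ : K →+* K)

omit [ValuativeRel K] in
/-- **Powers of the torus element**: for `a = d(ϖ, (σϖ)⁻¹)`, `aᵐ = d(ϖᵐ, ((σϖ)⁻¹)ᵐ)` and `a⁻ᵐ = d((ϖ⁻¹)ᵐ, (σϖ)ᵐ)`. [folklore] -/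
theorem coe_pow_of_coe_eq_diag {ϖ : K} (a : GL (Fin 2) K) (ha : (a : Matrix (Fin 2) (Fin 2) K) = !![ϖ, 0; 0, (σ ϖ)⁻¹])
    (ha' : ((a⁻¹ : GL (Fin 2) K) : Matrix (Fin 2) (Fin 2) K) = !![ϖ⁻¹, 0; 0, σ ϖ]) (m : ℕ) :
    ((a ^ m : GL (Fin 2) K) : Matrix (Fin 2) (Fin 2) K) = !![ϖ ^ m, 0; 0, ((σ ϖ)⁻¹) ^ m] ∧
      (((a ^ m)⁻¹ : GL (Fin 2) K) : Matrix (Fin 2) (Fin 2) K) = !![(ϖ⁻¹) ^ m, 0; 0, (σ ϖ) ^ m] := by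
  induction m with
  | zero => constructor <;> simp [Matrix.one_fin_two]
  | succ m ih =>
    constructor
    · rw [pow_succ, Units.val_mul, ih.1, ha]
      ext i j; fin_cases i <;> fin_cases j <;> simp [Matrix.mul_apply, Fin.sum_univ_two, pow_succ]
    · rw [pow_succ, _root_.mul_inv_rev, Units.val_mul, ha', ih.2]
      ext i j; fin_cases i <;> fin_cases j <;> simp [Matrix.mul_apply, Fin.sum_univ_two, pow_succ]
      all_goals ring

/-! ## §2 The Cartan-type exhaustion `U = ⋃_{n ≥ 0} K′ t₁ⁿ K′ · Z` -/

/-- **`U(σ, Φ₂)(K) = ⋃_{n ≥ 0} K′ t₁ⁿ K′ · Z`** — `K` a non-archimedean local field, `σ` an isometric involution, `ση = −η ≠ 0`, `P = d(1, η)`,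
`K′ = U ∩ P GL₂(𝒪) P⁻¹`, `ϖ` a uniformiser, `t₁ = d(ϖ, (σϖ)⁻¹)`: every `g ∈ U` is `k₁ t₁ⁿ k₂ z` with `k₁, k₂ ∈ K′`, `n : ℕ` and `z ∈ U` a SCALAR matrix (hence
central).  PROOF: the Cartan normal form of the symplectic model (★ p855507 `exists_glInt_mul_mul_offDiag_eq_zero`) conjugated by `P` gives `k₁ g k₂ = d(p, (σp)⁻¹)`;
in the DVR `𝒪_K`, `p = u ϖᵐ` or `p⁻¹ = u ϖᵐ` with `u` a unit (Mathlib `IsDiscreteValuationRing.eq_unit_mul_pow_irreducible`); `d(uϖᵐ, ⋯) = t₁ᵐ d(u,(σu)⁻¹)` and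
`d(u⁻¹ϖ⁻ᵐ, ⋯) = (w′ t₁ w′⁻¹ c)ᵐ d(u⁻¹, σu) = w′ t₁ᵐ w′⁻¹ · d(u⁻¹,σu) · cᵐ` with `w′ = [[0,η⁻¹],[−η,0]] ∈ K′` and the central unit scalar `c = σϖ∕ϖ`.
[cite: Tits1979, §3.3.3] [cite: BernsteinZelevinsky1976, §3.18–3.21] [cite: CartierCorvallis1979, §IV.1] -/
theorem exists_etaLevel_mul_pow_mul_scalar [TopologicalSpace K] [IsNonarchimedeanLocalField K] (hσ : ∀ z, σ (σ z) = z)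
    (hσv : ∀ z, valuation K (σ z) = valuation K z) {η : K} (hη : σ η = -η) (hη0 : η ≠ 0)
    (P : GL (Fin 2) K) (hP : (P : Matrix (Fin 2) (Fin 2) K) = !![1, 0; 0, η]) {J : Matrix (Fin 2) (Fin 2) K} (hJ : J = !![0, 1; 1, 0])
    {ϖ : K} (hϖ : IsUniformizingElement ϖ) (a : GL (Fin 2) K) (ha : (a : Matrix (Fin 2) (Fin 2) K) = !![ϖ, 0; 0, (σ ϖ)⁻¹])
    (ha' : ((a⁻¹ : GL (Fin 2) K) : Matrix (Fin 2) (Fin 2) K) = !![ϖ⁻¹, 0; 0, σ ϖ]) (g : GL (Fin 2) K) (hg : g ∈ unitaryGroupOfForm σ J) :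
    ∃ k₁ k₂ z : GL (Fin 2) K, ∃ n : ℕ,
      k₁ ∈ unitaryGroupOfForm σ J ∧ k₁ ∈ (glInt 2 K).map (MulAut.conj P).toMonoidHom ∧
      k₂ ∈ unitaryGroupOfForm σ J ∧ k₂ ∈ (glInt 2 K).map (MulAut.conj P).toMonoidHom ∧
      z ∈ unitaryGroupOfForm σ J ∧ (∃ c : K, (z : Matrix (Fin 2) (Fin 2) K) = !![c, 0; 0, c]) ∧ g = k₁ * a ^ n * k₂ * z := by
  haveI : T2Space K := (Literature.NumberTheory.GaloisRepresentations.IsNonarchimedeanLocalField.isLocalField K).toT2Space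
  have hϖ0 : ϖ ≠ 0 := hϖ.ne_zero
  have hσϖ0 : σ ϖ ≠ 0 := fun h => hϖ0 (by rw [← hσ ϖ, h, map_zero])
  have hvϖ1 : valuation K ϖ ≤ 1 := hϖ.valuation_le_one
  -- Step 1: the Cartan normal form of the symplectic model, conjugated by `P`
  have hform : formCongr σ P J = η • !![(0 : K), 1; -1, 0] := K2E1RamifiedSpecialGelfandPairU2.formCongr_diag_antidiagOne σ hη P hP hJ
  have heq : unitaryGroupOfForm σ (η • !![(0 : K), 1; -1, 0]) = unitaryGroupOfForm σ !![(0 : K), 1; -1, 0] :=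
    K2E1RamifiedSpecialGelfandPairU2.unitaryGroupOfForm_smul_eq σ _ hη0
  have hback : ∀ x : GL (Fin 2) K, x ∈ unitaryGroupOfForm σ !![(0 : K), 1; -1, 0] → P * x * P⁻¹ ∈ unitaryGroupOfForm σ J := by
    intro x hx
    rw [conj_mem_unitaryGroupOfForm_iff, hform, heq]; exact hx
  have hg'' : P⁻¹ * g * P ∈ unitaryGroupOfForm σ !![(0 : K), 1; -1, 0] := by
    rw [← heq, ← hform, ← conj_mem_unitaryGroupOfForm_iff]
    have : P * (P⁻¹ * g * P) * P⁻¹ = g := by group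
    rw [this]; exact hg
  obtain ⟨k₁, k₂, hk₁U, hk₁I, hk₂U, hk₂I, hD01, hD10⟩ :=
    K2E1SymplecticModelU2GelfandPair.exists_glInt_mul_mul_offDiag_eq_zero σ hσ hg''
  obtain ⟨D, hD⟩ : ∃ D : GL (Fin 2) K, D = k₁ * (P⁻¹ * g * P) * k₂ := ⟨_, rfl⟩
  rw [← hD] at hD01 hD10
  have hDU : D ∈ unitaryGroupOfForm σ !![(0 : K), 1; -1, 0] := hD ▸ mul_mem (mul_mem hk₁U hg'') hk₂U
  set p := (D : Matrix (Fin 2) (Fin 2) K) 0 0 with hp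
  set q := (D : Matrix (Fin 2) (Fin 2) K) 1 1 with hq
  obtain ⟨-, f2, -, -⟩ := K2E1SymplecticModelU2GelfandPair.rel_of_mem hDU
  rw [hD01, hD10, mul_zero, sub_zero, ← hp, ← hq] at f2
  -- `f2 : σ p * q = 1`
  have hσp0 : σ p ≠ 0 := fun h => by rw [h, zero_mul] at f2; exact zero_ne_one f2
  have hp0 : p ≠ 0 := fun h => hσp0 (by rw [h, map_zero])
  have hqe : q = (σ p)⁻¹ := eq_inv_of_mul_eq_one_right f2
  have hDmat : (D : Matrix (Fin 2) (Fin 2) K) = !![p, 0; 0, (σ p)⁻¹] := by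
    rw [Matrix.eta_fin_two (D : Matrix (Fin 2) (Fin 2) K), hD01, hD10, ← hp, ← hq, hqe]
  -- `P D P⁻¹ = D`, and the `K′`-elements `K₁ = P k₁ P⁻¹`, `K₂ = P k₂ P⁻¹` with `K₁ g K₂ = D`
  have hPi := coe_inv_of_coe_eq_diag hη0 P hP
  have hPD : P * D * P⁻¹ = D := by
    apply Units.ext
    rw [Units.val_mul, Units.val_mul, hP, hDmat, hPi]
    ext i j; fin_cases i <;> fin_cases j <;> simp [Matrix.mul_apply, Fin.sum_univ_two]
    rw [mul_comm η, mul_assoc, mul_inv_cancel₀ hη0, mul_one]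
  have hK₁U : P * k₁ * P⁻¹ ∈ unitaryGroupOfForm σ J := hback k₁ hk₁U
  have hK₂U : P * k₂ * P⁻¹ ∈ unitaryGroupOfForm σ J := hback k₂ hk₂U
  have hK₁I : P * k₁ * P⁻¹ ∈ (glInt 2 K).map (MulAut.conj P).toMonoidHom := Subgroup.mem_map.2 ⟨k₁, hk₁I, rfl⟩
  have hK₂I : P * k₂ * P⁻¹ ∈ (glInt 2 K).map (MulAut.conj P).toMonoidHom := Subgroup.mem_map.2 ⟨k₂, hk₂I, rfl⟩
  have hgD : g = (P * k₁ * P⁻¹)⁻¹ * D * (P * k₂ * P⁻¹)⁻¹ := by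
    rw [← hPD, hD]; group
  -- Step 2: the DVR `𝒪_K` and the irreducible `ϖ`
  have hirr : Irreducible (⟨ϖ, hϖ.mem⟩ : 𝒪[K]) := (IsDiscreteValuationRing.irreducible_iff_uniformizer _).2 hϖ.span_eq
  have hdvr : ∀ x : K, x ≠ 0 → valuation K x ≤ 1 → ∃ m : ℕ, ∃ u : K, valuation K u = 1 ∧ x = u * ϖ ^ m := by
    intro x hx0 hx1
    have hxO : x ∈ 𝒪[K] := (Valuation.mem_integer_iff _ _).2 hx1
    have hx0' : (⟨x, hxO⟩ : 𝒪[K]) ≠ 0 := fun h => hx0 (congrArg Subtype.val h)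
    obtain ⟨m, u, hu⟩ := IsDiscreteValuationRing.eq_unit_mul_pow_irreducible hx0' hirr
    refine ⟨m, ((u : 𝒪[K]) : K), (Valuation.integer.integers (valuation K)).isUnit_iff_valuation_eq_one.1 u.isUnit, ?_⟩
    have := congrArg Subtype.val hu
    simpa using this
  -- explicit elements: unit diagonals, the Weyl element `w′`, scalars
  have hdiag : ∀ u : K, valuation K u = 1 → ∃ d : GL (Fin 2) K, (d : Matrix (Fin 2) (Fin 2) K) = !![u, 0; 0, (σ u)⁻¹] ∧
      d ∈ unitaryGroupOfForm σ J ∧ d ∈ (glInt 2 K).map (MulAut.conj P).toMonoidHom := by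
    intro u hu
    have hu0 : u ≠ 0 := fun h => by rw [h, map_zero] at hu; exact zero_ne_one hu
    have hσu0 : σ u ≠ 0 := fun h => hu0 (by rw [← hσ u, h, map_zero])
    obtain ⟨d, hd, hd'⟩ : ∃ d : GL (Fin 2) K, (d : Matrix (Fin 2) (Fin 2) K) = !![u, 0; 0, (σ u)⁻¹] ∧
        ((d⁻¹ : GL (Fin 2) K) : Matrix (Fin 2) (Fin 2) K) = !![u⁻¹, 0; 0, ((σ u)⁻¹)⁻¹] :=
      ⟨⟨!![u, 0; 0, (σ u)⁻¹], !![u⁻¹, 0; 0, ((σ u)⁻¹)⁻¹], by simp [Matrix.one_fin_two, mul_inv_cancel₀ hu0, inv_mul_cancel₀ hσu0],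
        by simp [Matrix.one_fin_two, inv_mul_cancel₀ hu0, mul_inv_cancel₀ hσu0]⟩, rfl, rfl⟩
    refine ⟨d, hd, mem_of_coe_eq hJ hd ?_, diag_mem_conj_glInt hη0 P hP hd hd' hu ?_⟩
    · ext i j; fin_cases i <;> fin_cases j <;> simp [Matrix.mul_apply, Fin.sum_univ_two, map_inv₀, hσ, inv_mul_cancel₀ hu0, mul_inv_cancel₀ hσu0]
    · rw [map_inv₀, hσv, hu, inv_one]
  obtain ⟨w', hw', hw'i⟩ : ∃ x : GL (Fin 2) K, (x : Matrix (Fin 2) (Fin 2) K) = !![0, η⁻¹; -η, 0] ∧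
      ((x⁻¹ : GL (Fin 2) K) : Matrix (Fin 2) (Fin 2) K) = !![0, -η⁻¹; η, 0] :=
    ⟨⟨!![0, η⁻¹; -η, 0], !![0, -η⁻¹; η, 0], by simp [Matrix.one_fin_two, inv_mul_cancel₀ hη0, mul_inv_cancel₀ hη0],
      by simp [Matrix.one_fin_two, inv_mul_cancel₀ hη0, mul_inv_cancel₀ hη0]⟩, rfl, rfl⟩
  have hση' : σ η⁻¹ = -η⁻¹ := by rw [map_inv₀, hη, inv_neg]
  have hw'U : w' ∈ unitaryGroupOfForm σ J := mem_of_coe_eq hJ hw' (by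
    ext i j; fin_cases i <;> fin_cases j <;> simp [Matrix.mul_apply, Fin.sum_univ_two, hη, hση', inv_mul_cancel₀ hη0, mul_inv_cancel₀ hη0])
  have hw'I : w' ∈ (glInt 2 K).map (MulAut.conj P).toMonoidHom := by
    have h1 : ((P⁻¹ * w' * P : GL (Fin 2) K) : Matrix (Fin 2) (Fin 2) K) = !![0, 1; -1, 0] := by
      rw [Units.val_mul, Units.val_mul, hPi, hw', hP]
      ext i j; fin_cases i <;> fin_cases j <;> simp [Matrix.mul_apply, Fin.sum_univ_two, inv_mul_cancel₀ hη0]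
    have h2 : (((P⁻¹ * w' * P)⁻¹ : GL (Fin 2) K) : Matrix (Fin 2) (Fin 2) K) = !![0, -1; 1, 0] := by
      rw [Matrix.coe_units_inv, h1]; exact Matrix.inv_eq_right_inv (by simp [Matrix.one_fin_two])
    rw [mem_conj_glInt_iff, mem_glInt_iff, h1, h2]
    refine ⟨fun i j => ?_, fun i j => ?_⟩ <;> fin_cases i <;> fin_cases j <;> simp [one_mem, zero_mem]
  -- the central unit scalar `c = σϖ/ϖ` with `w′ a w′⁻¹ · c = a⁻¹`
  obtain ⟨c, hc⟩ : ∃ c : K, c = σ ϖ * ϖ⁻¹ := ⟨_, rfl⟩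
  have hc0 : c ≠ 0 := by rw [hc]; exact mul_ne_zero hσϖ0 (inv_ne_zero hϖ0)
  have hσc : σ c * c = 1 := by rw [hc, map_mul, map_inv₀, hσ]; field_simp
  obtain ⟨s, hs, hs'⟩ : ∃ x : GL (Fin 2) K, (x : Matrix (Fin 2) (Fin 2) K) = !![c, 0; 0, c] ∧
      ((x⁻¹ : GL (Fin 2) K) : Matrix (Fin 2) (Fin 2) K) = !![c⁻¹, 0; 0, c⁻¹] :=
    ⟨⟨!![c, 0; 0, c], !![c⁻¹, 0; 0, c⁻¹], by simp [Matrix.one_fin_two, mul_inv_cancel₀ hc0], by simp [Matrix.one_fin_two, inv_mul_cancel₀ hc0]⟩,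
      rfl, rfl⟩
  have hsU : s ∈ unitaryGroupOfForm σ J := mem_of_coe_eq hJ hs (by
    ext i j; fin_cases i <;> fin_cases j <;> simp [Matrix.mul_apply, Fin.sum_univ_two, hσc])
  have hscomm : ∀ x : GL (Fin 2) K, x * s = s * x := by
    intro x; apply Units.ext
    rw [Units.val_mul, Units.val_mul, hs, Matrix.eta_fin_two (x : Matrix (Fin 2) (Fin 2) K)]
    simp [mul_comm c]
  have hainv : a⁻¹ = w' * a * w'⁻¹ * s := by
    apply Units.ext
    rw [ha', Units.val_mul, Units.val_mul, Units.val_mul, hw', ha, hw'i, hs]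
    ext i j; fin_cases i <;> fin_cases j <;> simp [Matrix.mul_apply, Fin.sum_univ_two, hc]
    · field_simp
    · field_simp
  have hainvpow : ∀ m : ℕ, (a⁻¹) ^ m = w' * a ^ m * w'⁻¹ * s ^ m := by
    intro m
    rw [hainv, (show Commute (w' * a * w'⁻¹) s from hscomm _).mul_pow, conj_pow]
  have hsc : ∀ (m : ℕ) (x : GL (Fin 2) K), x * s ^ m = s ^ m * x := fun m x => ((show Commute x s from hscomm x).pow_right m).eq
  have hspow_mat : ∀ m : ℕ, ((s ^ m : GL (Fin 2) K) : Matrix (Fin 2) (Fin 2) K) = !![c ^ m, 0; 0, c ^ m] := by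
    intro m
    induction m with
    | zero => simp [Matrix.one_fin_two]
    | succ m ih =>
      rw [pow_succ, Units.val_mul, ih, hs]
      ext i j; fin_cases i <;> fin_cases j <;> simp [Matrix.mul_apply, Fin.sum_univ_two, pow_succ]
  have hspow : ∀ m : ℕ, s ^ m ∈ unitaryGroupOfForm σ J ∧ ∃ c' : K, ((s ^ m : GL (Fin 2) K) : Matrix (Fin 2) (Fin 2) K) = !![c', 0; 0, c'] :=
    fun m => ⟨pow_mem hsU m, c ^ m, hspow_mat m⟩
  -- Step 3: `p = u ϖᵐ` or `p⁻¹ = u ϖᵐ`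
  rcases le_or_gt (valuation K p) 1 with hle | hgt
  · obtain ⟨m, u, hu, hpu⟩ := hdvr p hp0 hle
    obtain ⟨d, hd, hdU, hdI⟩ := hdiag u hu
    have hu0 : u ≠ 0 := fun h => by rw [h, map_zero] at hu; exact zero_ne_one hu
    -- `D = aᵐ d(u, (σu)⁻¹)`
    have hDeq : D = a ^ m * d := by
      apply Units.ext
      rw [hDmat, Units.val_mul, (coe_pow_of_coe_eq_diag σ a ha ha' m).1, hd, hpu]
      ext i j; fin_cases i <;> fin_cases j <;> simp [Matrix.mul_apply, Fin.sum_univ_two, map_mul, map_pow, mul_comm]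
    refine ⟨(P * k₁ * P⁻¹)⁻¹, d * (P * k₂ * P⁻¹)⁻¹, 1, m, inv_mem hK₁U, inv_mem hK₁I, mul_mem hdU (inv_mem hK₂U),
      mul_mem hdI (inv_mem hK₂I), one_mem _, ⟨1, by simp [Matrix.one_fin_two]⟩, ?_⟩
    rw [hgD, hDeq]; group
  · have hpi1 : valuation K p⁻¹ ≤ 1 := by rw [map_inv₀]; exact inv_le_one_of_one_le₀ hgt.le
    obtain ⟨m, u, hu, hpu⟩ := hdvr p⁻¹ (inv_ne_zero hp0) hpi1
    have hu0 : u ≠ 0 := fun h => by rw [h, map_zero] at hu; exact zero_ne_one hu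
    have hu' : valuation K u⁻¹ = 1 := by rw [map_inv₀, hu, inv_one]
    obtain ⟨d, hd, hdU, hdI⟩ := hdiag u⁻¹ hu'
    -- `D = (a⁻¹)ᵐ d(u⁻¹, σu) = w′ aᵐ w′⁻¹ sᵐ d`
    have hpe : p = u⁻¹ * (ϖ ^ m)⁻¹ := by
      have := congrArg (·⁻¹) hpu; simp only [inv_inv, mul_inv] at this; exact this
    have hDeq : D = (a⁻¹) ^ m * d := by
      apply Units.ext
      rw [hDmat, Units.val_mul, inv_pow, (coe_pow_of_coe_eq_diag σ a ha ha' m).2, hd, hpe]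
      ext i j; fin_cases i <;> fin_cases j <;> simp [Matrix.mul_apply, Fin.sum_univ_two, map_mul, map_pow, map_inv₀, mul_comm]
    obtain ⟨hsmU, c', hc'⟩ := hspow m
    refine ⟨(P * k₁ * P⁻¹)⁻¹ * w', w'⁻¹ * d * (P * k₂ * P⁻¹)⁻¹, s ^ m, m, mul_mem (inv_mem hK₁U) hw'U, mul_mem (inv_mem hK₁I) hw'I,
      mul_mem (mul_mem (inv_mem hw'U) hdU) (inv_mem hK₂U), mul_mem (mul_mem (inv_mem hw'I) hdI) (inv_mem hK₂I), hsmU, ⟨c', hc'⟩, ?_⟩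
    rw [hgD, hDeq, hainvpow m]
    have : s ^ m * d * (P * k₂ * P⁻¹)⁻¹ = d * (P * k₂ * P⁻¹)⁻¹ * s ^ m := by rw [mul_assoc, ← hsc m, mul_assoc]
    calc (P * k₁ * P⁻¹)⁻¹ * (w' * a ^ m * w'⁻¹ * s ^ m * d) * (P * k₂ * P⁻¹)⁻¹
        = (P * k₁ * P⁻¹)⁻¹ * w' * a ^ m * w'⁻¹ * (s ^ m * d * (P * k₂ * P⁻¹)⁻¹) := by group
      _ = (P * k₁ * P⁻¹)⁻¹ * w' * a ^ m * (w'⁻¹ * d * (P * k₂ * P⁻¹)⁻¹) * s ^ m := by rw [this]; group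

/-! ## §3 The unipotent radical: explicit form, conjugation by `t₁ᵐ`, membership in `K′` and in congruence subgroups -/

omit [ValuativeRel K] in
/-- An element of the unipotent radical `N` of `U(σ, Φ₂)` is `[[1, b],[0, 1]]` with `b` its `(0,1)` entry. [cite: Rogawski1990, §1.10 p. 9] -/
theorem coe_eq_of_mem_unipotentU {J : Matrix (Fin 2) (Fin 2) K} {n : ↥(unitaryGroupOfForm σ J)} (hn : n ∈ unipotentU σ J) :
    ((n : GL (Fin 2) K) : Matrix (Fin 2) (Fin 2) K) = !![1, ((n : GL (Fin 2) K) : Matrix (Fin 2) (Fin 2) K) 0 1; 0, 1] := by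
  obtain ⟨htri, hdiag⟩ := (mem_unipotentU_iff n).1 hn
  have h10 : ((n : GL (Fin 2) K) : Matrix (Fin 2) (Fin 2) K) 1 0 = 0 := htri (by decide)
  conv_lhs => rw [Matrix.eta_fin_two ((n : GL (Fin 2) K) : Matrix (Fin 2) (Fin 2) K)]
  rw [h10, hdiag 0, hdiag 1]

omit [ValuativeRel K] in
/-- A `GL₂` element with matrix `[[1, b],[0, 1]]` lying in `U(σ, J)` belongs to the unipotent radical `N`. [cite: Rogawski1990, §1.10 p. 9] -/
theorem mem_unipotentU_of_coe_eq {J : Matrix (Fin 2) (Fin 2) K} (n : ↥(unitaryGroupOfForm σ J)) {b : K}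
    (hn : ((n : GL (Fin 2) K) : Matrix (Fin 2) (Fin 2) K) = !![1, b; 0, 1]) : n ∈ unipotentU σ J := by
  rw [mem_unipotentU_iff, hn]
  refine ⟨fun i j hij => ?_, fun i => ?_⟩
  · fin_cases i <;> fin_cases j <;> simp at hij ⊢
  · fin_cases i <;> simp

omit [ValuativeRel K] in
/-- **Conjugating a unipotent by `t₁ᵐ`**: `t₁ᵐ [[1,b],[0,1]] t₁⁻ᵐ = [[1, (ϖσϖ)ᵐ b],[0,1]]`, and its inverse is `[[1, −(ϖσϖ)ᵐ b],[0,1]]`.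
[cite: Casselman1995, Prop. 1.4.3] -/
theorem coe_pow_mul_mul_pow_inv {ϖ : K} (hϖ0 : ϖ ≠ 0) (a : GL (Fin 2) K) (ha : (a : Matrix (Fin 2) (Fin 2) K) = !![ϖ, 0; 0, (σ ϖ)⁻¹])
    (ha' : ((a⁻¹ : GL (Fin 2) K) : Matrix (Fin 2) (Fin 2) K) = !![ϖ⁻¹, 0; 0, σ ϖ]) {X : GL (Fin 2) K} {b : K}
    (hX : (X : Matrix (Fin 2) (Fin 2) K) = !![1, b; 0, 1]) (m : ℕ) :
    ((a ^ m * X * (a ^ m)⁻¹ : GL (Fin 2) K) : Matrix (Fin 2) (Fin 2) K) = !![1, (ϖ * σ ϖ) ^ m * b; 0, 1] ∧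
      (((a ^ m * X * (a ^ m)⁻¹)⁻¹ : GL (Fin 2) K) : Matrix (Fin 2) (Fin 2) K) = !![1, -((ϖ * σ ϖ) ^ m * b); 0, 1] := by
  have hσϖ0 : σ ϖ ≠ 0 := fun h => by
    have : ((a : Matrix (Fin 2) (Fin 2) K)).det = 0 := by rw [ha, Matrix.det_fin_two_of, h]; simp
    exact (Matrix.GeneralLinearGroup.det a).ne_zero (by rw [Matrix.GeneralLinearGroup.val_det_apply]; exact this)
  obtain ⟨h1, h2⟩ := coe_pow_of_coe_eq_diag σ a ha ha' m
  have hmat : ((a ^ m * X * (a ^ m)⁻¹ : GL (Fin 2) K) : Matrix (Fin 2) (Fin 2) K) = !![1, (ϖ * σ ϖ) ^ m * b; 0, 1] := by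
    rw [Units.val_mul, Units.val_mul, h1, hX, h2]
    ext i j; fin_cases i <;> fin_cases j <;> simp [Matrix.mul_apply, Fin.sum_univ_two, mul_pow, inv_pow]
    · rw [mul_inv_cancel₀ (pow_ne_zero m hϖ0)]
    · ring
    · rw [inv_mul_cancel₀ (pow_ne_zero m hσϖ0)]
  refine ⟨hmat, ?_⟩
  rw [Matrix.coe_units_inv, hmat]
  exact Matrix.inv_eq_right_inv (by simp [Matrix.one_fin_two])

/-- **`[[1,c],[0,1]] ∈ P GL₂(𝒪) P⁻¹ ⇔ |c η| ≤ 1`** (`P = d(1,η)`: `P⁻¹ [[1,c],[0,1]] P = [[1, cη],[0,1]]`). [folklore] -/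
theorem upper_mem_conj_glInt_iff {η : K} (hη0 : η ≠ 0) (P : GL (Fin 2) K) (hP : (P : Matrix (Fin 2) (Fin 2) K) = !![1, 0; 0, η])
    {X : GL (Fin 2) K} {c : K} (hX : (X : Matrix (Fin 2) (Fin 2) K) = !![1, c; 0, 1]) :
    X ∈ (glInt 2 K).map (MulAut.conj P).toMonoidHom ↔ valuation K (c * η) ≤ 1 := by
  have hPi := coe_inv_of_coe_eq_diag hη0 P hP
  have h1 : ((P⁻¹ * X * P : GL (Fin 2) K) : Matrix (Fin 2) (Fin 2) K) = !![1, c * η; 0, 1] := by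
    rw [Units.val_mul, Units.val_mul, hPi, hX, hP]
    ext i j; fin_cases i <;> fin_cases j <;> simp [Matrix.mul_apply, Fin.sum_univ_two, inv_mul_cancel₀ hη0]
  have h2 : (((P⁻¹ * X * P)⁻¹ : GL (Fin 2) K) : Matrix (Fin 2) (Fin 2) K) = !![1, -(c * η); 0, 1] := by
    rw [Matrix.coe_units_inv, h1]; exact Matrix.inv_eq_right_inv (by simp [Matrix.one_fin_two])
  rw [mem_conj_glInt_iff, mem_glInt_iff, h1, h2]
  constructor
  · intro h; exact (Valuation.mem_integer_iff _ _).1 (by simpa using h.1 0 1)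
  · intro h
    have hO : c * η ∈ 𝒪[K] := (Valuation.mem_integer_iff _ _).2 h
    refine ⟨fun i j => ?_, fun i j => ?_⟩ <;> fin_cases i <;> fin_cases j <;> simp [hO, one_mem, zero_mem, neg_mem hO]

/-- A unipotent `[[1,c],[0,1]]` with `|c| ≤ γ ≤ 1` lies in the principal congruence subgroup `K_γ` of `GL₂(K)`. [cite: Casselman1995, Prop. 1.4.4] -/
theorem upper_mem_congruenceGL {X : GL (Fin 2) K} {c : K} (hX : (X : Matrix (Fin 2) (Fin 2) K) = !![1, c; 0, 1])
    {γ : ValueGroupWithZero K} (hγ : γ ≤ 1) (hc : valuation K c ≤ γ) : X ∈ congruenceGL 2 γ := by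
  have hXi : ((X⁻¹ : GL (Fin 2) K) : Matrix (Fin 2) (Fin 2) K) = !![1, -c; 0, 1] := by
    rw [Matrix.coe_units_inv, hX]; exact Matrix.inv_eq_right_inv (by simp [Matrix.one_fin_two])
  rw [mem_congruenceGL_iff, hX, hXi]
  refine ⟨⟨fun i j => ?_, fun i j => ?_⟩, fun i j => ?_, fun i j => ?_⟩ <;> fin_cases i <;> fin_cases j <;>
    simp [Matrix.one_fin_two, hc, hc.trans hγ, Valuation.map_neg]

/-- Archimedean bookkeeping in the value group: for `0 < x < 1` and any `y`, `δ ≠ 0`, some power has `xᵐ · y ≤ δ`. [folklore] -/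
theorem exists_pow_valuation_mul_le [TopologicalSpace K] [IsNonarchimedeanLocalField K] {x : ValueGroupWithZero K} (hx : x < 1)
    (y : ValueGroupWithZero K) {δ : ValueGroupWithZero K} (hδ : δ ≠ 0) : ∃ m : ℕ, x ^ m * y ≤ δ := by
  haveI : MulArchimedean (ValueGroupWithZero K) := ValuativeRel.isRankLeOne_iff_mulArchimedean.mp inferInstance
  rcases eq_or_ne y 0 with rfl | hy
  · exact ⟨0, by simp⟩
  obtain ⟨m, hm⟩ := exists_pow_lt₀ hx (Units.mk0 (δ * y⁻¹) (mul_ne_zero hδ (inv_ne_zero hy)))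
  refine ⟨m, ?_⟩
  rw [Units.val_mk0] at hm
  have := mul_le_mul_left hm.le y
  rwa [mul_assoc, inv_mul_cancel₀ hy, mul_one] at this

end Valued

end Summit.HodgeConjecture.HodgeConjecture.Cruxes.H413.K2E1CuspidalCartanU2
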